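import Mathlib
import HarnessLib
import Summits.Ventures.LatticeQCDFlow.Exactness.CircleUniformAngle
import Summits.Ventures.LatticeQCDFlow.Exactness.CPNMetropolisKicks
import Summits.Ventures.LatticeQCDFlow.Exactness.SymmetricMetropolis

/-!
# The wrapped-Gaussian rotation kick of the `cpn_2d` link Metropolis, on the circle `S¹ ⊂ ℝ²`: symmetric and one-step Doeblin

HONEST FRAMING: exact (Metropolis-corrected) sampling algorithms for lattice gauge theory;
figures of merit are autocorrelation/cost numbers at stated couplings and volumes; no
continuum-physics claim.

Venture `LatticeQCDFlow` (cell pub-lqcd), topic `Exactness`, FANOUT row 9 (eng-latcore, the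
engine `latflow.core.cpn_2d.metropolis_links`: propose `u ← u · e^{iεξ}`, `ξ` standard Gaussian).
NEW WORK of the cell over the tree (`CircleUniformAngle.lean`: `E2`, `mk2`, `circlePt`,
`lintegral_uniformSphere_two` — arc length, `lintegral_Ioc_periodic`; `CPNMetropolisKicks.lean`:
`smul_restrict_ball_le_gaussianReal`; `U1ExpChartMinorisation.map_mul_restrict_ball_real`;
`SymmetricMetropolis.lean`: `symMH_invariant`); Mathlib's `Complex.cos_arg` / `sin_arg`,
`gaussianReal_map_neg`, `lintegral_add_right_eq_self`.  Nothing is cited as a fact.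

THE POINT.  `CPNHeatBathErgodic.lean` models the links of the CP(N−1) quartic-action model as points
of the circle `sphere (0 : EuclideanSpace ℝ (Fin 2)) 1`; the engine's link proposal is the ROTATION of
that point by the Gaussian angle `εξ`.  In the angle chart `circlePt` (surjective: `exists_circlePt_eq`)
the rotation is a translation, the uniform law is `(2π)⁻¹ dψ` on a period, so translation invariance,
periodicity and the evenness of the Gaussian give (i) the kick is SYMMETRIC for `uniformSphere`, hence
the link Metropolis hit is exact (`symMH_invariant`), and (ii) it dominates
`(gaussianPDFReal 0 1 (π/ε) · ε⁻¹ · 2π) • uniformSphere` from EVERY link value — the two inputs of the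
generic scan theorem `SiteMetropolisScan.metropolisScan_uniformlyErgodic` for the link sites.

* §1 `rotCircle α` (rotation of `S¹ ⊂ ℝ²` by the angle `α`), `rotCircle_circlePt`
  (`= circlePt (θ + α)`), `exists_circlePt_eq`, `measurable_rotCircle₂`;
  `lintegral_Ioo_periodic_shift` (`∫_{(−π,π)} g(ψ + c) dψ = ∫_{(−π,π)} g` for `2π`-periodic `g`).
* §2 `circleRotKick ε u` (the proposal law), `circleRotKernel ε` (as a Markov kernel, `_apply`);
  **`smul_uniformSphere_le_circleRotKick`** (one-step Doeblin from every `u`);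
  **`compProd_circleRotKernel_swap`** (uniformSphere-symmetry);
  **`cpnLinkMetropolis_invariant`** — the `cpn_2d` link Metropolis hit
  `symMH (circleRotKernel ε) p` is EXACT for `p · uniformSphere`, every measurable `p > 0`.

NOT CLAIMED: the sweep instance on `CPNConfig` (one screen over `SiteMetropolisScan`, to do); any
sharp constant.
-/

noncomputable section

namespace Summit.Ventures.LatticeQCDFlow.Exactness

open MeasureTheory Measure Metric Set ProbabilityTheory Function Real
open scoped ENNReal

/-! ## §1 Rotations of the circle `S¹ ⊂ ℝ²` and the angle chart -/

/-- A point of `E2` is `mk2` of its two coordinates. -/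
theorem mk2_coords (u : E2) : mk2 (u 0, u 1) = u := by
  ext j
  fin_cases j <;> simp

/-- On the unit circle, `x² + y² = 1`. -/
theorem sq_add_sq_of_mem_sphere (u : sphere (0 : E2) 1) : (u : E2) 0 ^ 2 + (u : E2) 1 ^ 2 = 1 := by
  have h : ‖(u : E2)‖ = 1 := by simp
  rw [← mk2_coords (u : E2), norm_mk2, Real.sqrt_eq_one] at h
  simpa using h

/-- **Rotation of the circle by the angle `α`.** -/
def rotCircle (α : ℝ) (u : sphere (0 : E2) 1) : sphere (0 : E2) 1 :=
  ⟨mk2 ((u : E2) 0 * Real.cos α - (u : E2) 1 * Real.sin α, (u : E2) 0 * Real.sin α + (u : E2) 1 * Real.cos α), by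
    rw [mem_sphere_zero_iff_norm, norm_mk2, Real.sqrt_eq_one]
    have h := sq_add_sq_of_mem_sphere u
    have hc := Real.cos_sq_add_sin_sq α
    simp only
    nlinarith [h, hc]⟩

/-- In the angle chart a rotation is a translation: `rotCircle α (circlePt θ) = circlePt (θ + α)`. -/
theorem rotCircle_circlePt (α θ : ℝ) : rotCircle α (circlePt θ) = circlePt (θ + α) := by
  apply Subtype.ext
  simp only [rotCircle, circlePt_coe, mk2_apply_zero, mk2_apply_one, Real.cos_add, Real.sin_add]
  congr 1
  exact Prod.ext (by ring) (by ring)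

/-- **The angle chart is onto**: every point of the circle is `circlePt ψ` for some `ψ`. -/
theorem exists_circlePt_eq (u : sphere (0 : E2) 1) : ∃ ψ : ℝ, circlePt ψ = u := by
  set z : ℂ := ⟨(u : E2) 0, (u : E2) 1⟩ with hz
  have hnorm : ‖z‖ = 1 := by
    rw [Complex.norm_def, Complex.normSq_mk, Real.sqrt_eq_one]
    have h := sq_add_sq_of_mem_sphere u
    nlinarith [h]
  have hz0 : z ≠ 0 := by
    intro h; rw [h, norm_zero] at hnorm; exact zero_ne_one hnorm
  refine ⟨Complex.arg z, Subtype.ext ?_⟩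
  rw [circlePt_coe, Complex.cos_arg hz0, Complex.sin_arg, hnorm, div_one, div_one]
  exact mk2_coords (u : E2)

/-- The rotation kick map `(θ, u) ↦ rotCircle (ε θ) u` is jointly measurable. -/
theorem measurable_rotCircle₂ (ε : ℝ) : Measurable fun q : ℝ × sphere (0 : E2) 1 => rotCircle (ε * q.1) q.2 := by
  have h0 : Measurable fun q : ℝ × sphere (0 : E2) 1 => (q.2 : E2) 0 :=
    ((PiLp.continuous_apply 2 (fun _ : Fin 2 => ℝ) 0).comp (continuous_subtype_val.comp continuous_snd)).measurable
  have h1 : Measurable fun q : ℝ × sphere (0 : E2) 1 => (q.2 : E2) 1 :=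
    ((PiLp.continuous_apply 2 (fun _ : Fin 2 => ℝ) 1).comp (continuous_subtype_val.comp continuous_snd)).measurable
  have hc : Measurable fun q : ℝ × sphere (0 : E2) 1 => Real.cos (ε * q.1) :=
    Real.measurable_cos.comp (measurable_fst.const_mul ε)
  have hs : Measurable fun q : ℝ × sphere (0 : E2) 1 => Real.sin (ε * q.1) :=
    Real.measurable_sin.comp (measurable_fst.const_mul ε)
  exact (measurable_mk2.comp (((h0.mul hc).sub (h1.mul hs)).prodMk ((h0.mul hs).add (h1.mul hc)))).subtype_mk

/-- For fixed `u`, `θ ↦ rotCircle (ε θ) u` is measurable. -/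
theorem measurable_rotCircle_left (ε : ℝ) (u : sphere (0 : E2) 1) : Measurable fun θ : ℝ => rotCircle (ε * θ) u :=
  (measurable_rotCircle₂ ε).comp (measurable_id.prodMk measurable_const)

/-- **A periodic integrand may be shifted on a period**: `∫_{(−π,π)} g(ψ + c) dψ = ∫_{(−π,π)} g(ψ) dψ`
for `2π`-periodic measurable `g`. -/
theorem lintegral_Ioo_periodic_shift {g : ℝ → ℝ≥0∞} (hper : Function.Periodic g (2 * π)) (c : ℝ) :
    ∫⁻ ψ in Ioo (-π) π, g (ψ + c) = ∫⁻ ψ in Ioo (-π) π, g ψ := by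
  have hIoo : Ioo (-π) π = Ioo (-π) (-π + 2 * π) := by ring_nf
  rw [hIoo, Measure.restrict_congr_set Ioo_ae_eq_Ioc]
  -- translate: `ψ ↦ ψ + c`
  have h1 : ∫⁻ ψ in Ioc (-π) (-π + 2 * π), g (ψ + c) = ∫⁻ y in Ioc (-π + c) (-π + c + 2 * π), g y := by
    rw [← lintegral_indicator measurableSet_Ioc, ← lintegral_indicator measurableSet_Ioc,
      ← lintegral_add_right_eq_self (μ := (volume : Measure ℝ)) (fun y => (Ioc (-π + c) (-π + c + 2 * π)).indicator g y) c]
    refine lintegral_congr fun ψ => ?_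
    by_cases h : ψ ∈ Ioc (-π) (-π + 2 * π)
    · have h' : ψ + c ∈ Ioc (-π + c) (-π + c + 2 * π) := ⟨by linarith [h.1], by linarith [h.2]⟩
      rw [indicator_of_mem h, indicator_of_mem h']
    · have h' : ψ + c ∉ Ioc (-π + c) (-π + c + 2 * π) := fun hh => h ⟨by linarith [hh.1], by linarith [hh.2]⟩
      rw [indicator_of_notMem h, indicator_of_notMem h']
  rw [h1, lintegral_Ioc_periodic hper (-π + c) (-π)]

/-! ## §2 The rotation kick: Doeblin, symmetry, exactness of the link Metropolis hit -/

/-- **The link proposal law of `cpn_2d.metropolis_links`** on the circle: rotate `u` by `ε ξ`,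
`ξ ∼ N(0, 1)`. -/
def circleRotKick (ε : ℝ) (u : sphere (0 : E2) 1) : Measure (sphere (0 : E2) 1) :=
  (gaussianReal 0 1).map fun θ => rotCircle (ε * θ) u

/-- The proposal law is a probability law. -/
instance isProbabilityMeasure_circleRotKick (ε : ℝ) (u : sphere (0 : E2) 1) : IsProbabilityMeasure (circleRotKick ε u) :=
  Measure.isProbabilityMeasure_map (measurable_rotCircle_left ε u).aemeasurable

/-- **The rotation-kick kernel** on the circle. -/
def circleRotKernel (ε : ℝ) : Kernel (sphere (0 : E2) 1) (sphere (0 : E2) 1) :=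
  Kernel.map (Kernel.const _ (gaussianReal 0 1) ×ₖ Kernel.deterministic id measurable_id)
    (fun q : ℝ × sphere (0 : E2) 1 => rotCircle (ε * q.1) q.2)

/-- The kernel at `u` is the kick law. -/
theorem circleRotKernel_apply (ε : ℝ) (u : sphere (0 : E2) 1) : circleRotKernel ε u = circleRotKick ε u := by
  rw [circleRotKernel, Kernel.map_apply _ (measurable_rotCircle₂ ε), Kernel.prod_apply, Kernel.const_apply,
    Kernel.deterministic_apply, Measure.prod_dirac, Measure.map_map (measurable_rotCircle₂ ε) measurable_prodMk_right]
  rfl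

/-- The kernel is Markov. -/
instance isMarkovKernel_circleRotKernel (ε : ℝ) : IsMarkovKernel (circleRotKernel ε) := by
  unfold circleRotKernel; exact Kernel.IsMarkovKernel.map _ (measurable_rotCircle₂ ε)

/-- Arc length for a set: `∫_{(−π,π)} 1_A(circlePt θ) dθ = 2π · uniformSphere(A)`. -/
theorem lintegral_Ioo_indicator_circlePt {A : Set (sphere (0 : E2) 1)} (hA : MeasurableSet A) :
    ∫⁻ θ in Ioo (-π) π, A.indicator (1 : sphere (0 : E2) 1 → ℝ≥0∞) (circlePt θ) =
      ENNReal.ofReal (2 * π) * uniformSphere (volume : Measure E2) A := by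
  have h := lintegral_uniformSphere_two (G := A.indicator 1) (measurable_one.indicator hA)
  rw [lintegral_indicator_one hA, lintegral_const_mul' _ _ ENNReal.ofReal_ne_top] at h
  rw [h, ← mul_assoc, ← ENNReal.ofReal_mul (by positivity), show 2 * π * (1 / (2 * π)) = 1 by field_simp,
    ENNReal.ofReal_one, one_mul]

/-- **THE LINK KICK IS ONE-STEP DOEBLIN**: for `ε > 0` and EVERY `u` on the circle,
`(gaussianPDFReal 0 1 (π/ε) · ε⁻¹ · 2π) • uniformSphere ≤ circleRotKick ε u`. -/
theorem smul_uniformSphere_le_circleRotKick {ε : ℝ} (hε : 0 < ε) (u : sphere (0 : E2) 1) :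
    (ENNReal.ofReal (gaussianPDFReal 0 1 (π / ε)) * ENNReal.ofReal ε⁻¹ * ENNReal.ofReal (2 * π)) •
      uniformSphere (volume : Measure E2) ≤ circleRotKick ε u := by
  obtain ⟨ψ₀, rfl⟩ := exists_circlePt_eq u
  refine Measure.le_iff.2 fun A hA => ?_
  have hmeas : Measurable fun θ : ℝ => rotCircle (ε * θ) (circlePt ψ₀) := measurable_rotCircle_left ε _
  rw [circleRotKick, Measure.map_apply hmeas hA, Measure.smul_apply, smul_eq_mul]
  -- the Gaussian dominates `pdf(π/ε) ·` Lebesgue on `|θ| < π/ε`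
  have h1 := Measure.le_iff.1 (smul_restrict_ball_le_gaussianReal (π / ε)) _ (hmeas hA)
  rw [Measure.smul_apply, smul_eq_mul, Measure.restrict_apply (hmeas hA)] at h1
  refine le_trans (le_of_eq ?_) h1
  -- Lebesgue of the angular preimage: scale by `ε`, shift by `ψ₀`, use arc length
  have hscale : volume ((fun θ : ℝ => rotCircle (ε * θ) (circlePt ψ₀)) ⁻¹' A ∩ ball 0 (π / ε)) =
      ENNReal.ofReal ε⁻¹ * ∫⁻ α in Ioo (-π) π, A.indicator (1 : sphere (0 : E2) 1 → ℝ≥0∞) (circlePt (α + ψ₀)) := by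
    have hset : (fun θ : ℝ => rotCircle (ε * θ) (circlePt ψ₀)) ⁻¹' A =
        (fun θ : ℝ => ε * θ) ⁻¹' ((fun α : ℝ => circlePt (α + ψ₀)) ⁻¹' A) := by
      ext θ
      simp only [mem_preimage, rotCircle_circlePt, add_comm ψ₀]
    have hAm : MeasurableSet ((fun α : ℝ => circlePt (α + ψ₀)) ⁻¹' A) :=
      (measurable_circlePt.comp (measurable_id.add_const ψ₀)) hA
    rw [hset, ← Measure.restrict_apply ((measurable_const_mul ε) hAm),
      ← Measure.map_apply (measurable_const_mul ε) hAm, map_mul_restrict_ball_real hε, Measure.smul_apply, smul_eq_mul,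
      show ε * (π / ε) = π by field_simp, Real.ball_eq_Ioo, zero_sub, zero_add, Measure.restrict_apply hAm,
      ← lintegral_indicator_one (hAm.inter measurableSet_Ioo)]
    congr 1
    rw [← lintegral_indicator measurableSet_Ioo]
    refine lintegral_congr fun α => ?_
    by_cases h1 : α ∈ Ioo (-π) π
    · rw [indicator_of_mem h1]
      by_cases h2 : circlePt (α + ψ₀) ∈ A
      · rw [indicator_of_mem (show α ∈ _ ∩ _ from ⟨h2, h1⟩), indicator_of_mem h2]; simp only [Pi.one_apply]
      · rw [indicator_of_notMem (show α ∉ _ ∩ _ from fun h => h2 h.1), indicator_of_notMem h2]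
    · rw [indicator_of_notMem h1, indicator_of_notMem (show α ∉ _ ∩ _ from fun h => h1 h.2)]
  have hper : Function.Periodic (fun x : ℝ => A.indicator (1 : sphere (0 : E2) 1 → ℝ≥0∞) (circlePt x)) (2 * π) :=
    fun x => by simp only [circlePt_add_two_pi]
  rw [hscale, show (∫⁻ α in Ioo (-π) π, A.indicator (1 : sphere (0 : E2) 1 → ℝ≥0∞) (circlePt (α + ψ₀))) =
      ∫⁻ α in Ioo (-π) π, A.indicator (1 : sphere (0 : E2) 1 → ℝ≥0∞) (circlePt α) from
      lintegral_Ioo_periodic_shift hper ψ₀, lintegral_Ioo_indicator_circlePt hA]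
  ring

/-- Integration against the kernel in the angle chart. -/
theorem lintegral_circleRotKernel (ε : ℝ) (ψ : ℝ) {G : sphere (0 : E2) 1 → ℝ≥0∞} (hG : Measurable G) :
    ∫⁻ v, G v ∂(circleRotKernel ε (circlePt ψ)) = ∫⁻ θ, G (circlePt (ψ + ε * θ)) ∂(gaussianReal 0 1) := by
  rw [circleRotKernel_apply, circleRotKick, lintegral_map hG (measurable_rotCircle_left ε _)]
  simp only [rotCircle_circlePt]

/-- The double integral `∫σ(du) ∫K(u,dv) f(u,v)` in the angle chart. -/
theorem lintegral_uniformSphere_circleRotKernel (ε : ℝ) {f : sphere (0 : E2) 1 × sphere (0 : E2) 1 → ℝ≥0∞}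
    (hf : Measurable f) :
    ∫⁻ u, ∫⁻ v, f (u, v) ∂(circleRotKernel ε u) ∂(uniformSphere (volume : Measure E2)) =
      ENNReal.ofReal (1 / (2 * π)) *
        ∫⁻ ψ in Ioo (-π) π, (∫⁻ θ, f (circlePt ψ, circlePt (ψ + ε * θ)) ∂(gaussianReal 0 1)) := by
  have hR : Measurable fun u : sphere (0 : E2) 1 => ∫⁻ v, f (u, v) ∂(circleRotKernel ε u) :=
    Measurable.lintegral_kernel_prod_right (κ := circleRotKernel ε) (f := fun (u v : sphere (0 : E2) 1) => f (u, v)) hf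
  rw [lintegral_uniformSphere_two hR, lintegral_const_mul' _ _ ENNReal.ofReal_ne_top]
  congr 1
  refine setLIntegral_congr_fun measurableSet_Ioo fun ψ _ => ?_
  exact lintegral_circleRotKernel ε ψ (hf.comp measurable_prodMk_left)

/-- The standard Gaussian is even: `∫ h(−θ) dγ = ∫ h dγ`. -/
theorem lintegral_gaussianReal_comp_neg {h : ℝ → ℝ≥0∞} (hh : Measurable h) :
    ∫⁻ θ, h (-θ) ∂(gaussianReal 0 1) = ∫⁻ θ, h θ ∂(gaussianReal 0 1) := by
  have hev : (gaussianReal 0 1).map (fun x : ℝ => -x) = gaussianReal 0 1 := by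
    rw [gaussianReal_map_neg, neg_zero]
  conv_rhs => rw [← hev]
  rw [lintegral_map hh measurable_neg]

/-- Tonelli for `dψ|_{(−π,π)} ⊗ γ`. -/
theorem lintegral_Ioo_gaussianReal_swap {F : ℝ × ℝ → ℝ≥0∞} (hF : Measurable F) :
    ∫⁻ ψ in Ioo (-π) π, (∫⁻ θ, F (ψ, θ) ∂(gaussianReal 0 1)) =
      ∫⁻ θ, (∫⁻ ψ in Ioo (-π) π, F (ψ, θ)) ∂(gaussianReal 0 1) :=
  lintegral_lintegral_swap (μ := (volume : Measure ℝ).restrict (Ioo (-π) π)) (ν := gaussianReal 0 1)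
    (f := fun ψ θ => F (ψ, θ)) hF.aemeasurable

/-- **The symmetric double integral in the angle chart**: `θ ↦ −θ` (the Gaussian is even), Tonelli,
and the shift `ψ ↦ ψ + εθ` over a period. -/
theorem angle_double_lintegral_symm (ε : ℝ) {f : sphere (0 : E2) 1 × sphere (0 : E2) 1 → ℝ≥0∞} (hf : Measurable f) :
    ∫⁻ ψ in Ioo (-π) π, (∫⁻ θ, f (circlePt (ψ + ε * θ), circlePt ψ) ∂(gaussianReal 0 1)) =
      ∫⁻ ψ in Ioo (-π) π, (∫⁻ θ, f (circlePt ψ, circlePt (ψ + ε * θ)) ∂(gaussianReal 0 1)) := by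
  have hF' : Measurable fun q : ℝ × ℝ => f (circlePt (q.1 + ε * q.2), circlePt q.1) :=
    hf.comp ((measurable_circlePt.comp (measurable_fst.add (measurable_snd.const_mul ε))).prodMk
      (measurable_circlePt.comp measurable_fst))
  have hG : Measurable fun q : ℝ × ℝ => f (circlePt q.1, circlePt (q.1 - ε * q.2)) :=
    hf.comp ((measurable_circlePt.comp measurable_fst).prodMk
      (measurable_circlePt.comp (measurable_fst.sub (measurable_snd.const_mul ε))))
  -- right side: `θ ↦ −θ`
  have hneg : ∀ ψ : ℝ, ∫⁻ θ, f (circlePt ψ, circlePt (ψ + ε * θ)) ∂(gaussianReal 0 1) =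
      ∫⁻ θ, f (circlePt ψ, circlePt (ψ - ε * θ)) ∂(gaussianReal 0 1) := by
    intro ψ
    have hm : Measurable fun θ : ℝ => f (circlePt ψ, circlePt (ψ - ε * θ)) :=
      hf.comp (measurable_const.prodMk (measurable_circlePt.comp (measurable_const.sub (measurable_const_mul ε))))
    calc ∫⁻ θ, f (circlePt ψ, circlePt (ψ + ε * θ)) ∂(gaussianReal 0 1)
        = ∫⁻ θ, f (circlePt ψ, circlePt (ψ - ε * -θ)) ∂(gaussianReal 0 1) :=
          lintegral_congr fun θ => by rw [mul_neg, sub_neg_eq_add]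
      _ = ∫⁻ θ, f (circlePt ψ, circlePt (ψ - ε * θ)) ∂(gaussianReal 0 1) := lintegral_gaussianReal_comp_neg hm
  -- the shift on a `θ`-slice
  have hshift : ∀ θ : ℝ, ∫⁻ ψ in Ioo (-π) π, f (circlePt (ψ + ε * θ), circlePt ψ) =
      ∫⁻ ψ in Ioo (-π) π, f (circlePt ψ, circlePt (ψ - ε * θ)) := by
    intro θ
    have hper : Function.Periodic (fun b : ℝ => f (circlePt (b + ε * θ), circlePt b)) (2 * π) := fun b => by
      simp only
      rw [show b + 2 * π + ε * θ = (b + ε * θ) + 2 * π by ring, circlePt_add_two_pi, circlePt_add_two_pi]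
    have h := lintegral_Ioo_periodic_shift hper (-(ε * θ))
    refine h.symm.trans (setLIntegral_congr_fun measurableSet_Ioo fun ψ _ => ?_)
    rw [neg_add_cancel_right, ← sub_eq_add_neg]
  -- Tonelli twice
  calc ∫⁻ ψ in Ioo (-π) π, (∫⁻ θ, f (circlePt (ψ + ε * θ), circlePt ψ) ∂(gaussianReal 0 1))
      = ∫⁻ θ, (∫⁻ ψ in Ioo (-π) π, f (circlePt (ψ + ε * θ), circlePt ψ)) ∂(gaussianReal 0 1) :=
        lintegral_Ioo_gaussianReal_swap (F := fun q : ℝ × ℝ => f (circlePt (q.1 + ε * q.2), circlePt q.1)) hF'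
    _ = ∫⁻ θ, (∫⁻ ψ in Ioo (-π) π, f (circlePt ψ, circlePt (ψ - ε * θ))) ∂(gaussianReal 0 1) :=
        lintegral_congr fun θ => hshift θ
    _ = ∫⁻ ψ in Ioo (-π) π, (∫⁻ θ, f (circlePt ψ, circlePt (ψ - ε * θ)) ∂(gaussianReal 0 1)) :=
        (lintegral_Ioo_gaussianReal_swap (F := fun q : ℝ × ℝ => f (circlePt q.1, circlePt (q.1 - ε * q.2))) hG).symm
    _ = ∫⁻ ψ in Ioo (-π) π, (∫⁻ θ, f (circlePt ψ, circlePt (ψ + ε * θ)) ∂(gaussianReal 0 1)) :=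
        setLIntegral_congr_fun measurableSet_Ioo fun ψ _ => (hneg ψ).symm

/-- **THE LINK KICK IS SYMMETRIC FOR THE UNIFORM LAW OF THE CIRCLE**:
`(σ ⊗ₘ K).map swap = σ ⊗ₘ K`, `σ = uniformSphere volume`. -/
theorem compProd_circleRotKernel_swap (ε : ℝ) :
    (uniformSphere (volume : Measure E2) ⊗ₘ circleRotKernel ε).map Prod.swap =
      uniformSphere (volume : Measure E2) ⊗ₘ circleRotKernel ε := by
  refine Measure.ext_of_lintegral _ (fun f hf => ?_)
  rw [lintegral_map hf measurable_swap,
    Measure.lintegral_compProd (f := fun z => f z.swap) (hf.comp measurable_swap),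
    Measure.lintegral_compProd hf]
  have h1 := lintegral_uniformSphere_circleRotKernel ε (f := fun z => f z.swap) (hf.comp measurable_swap)
  simp only [Prod.swap_prod_mk] at h1 ⊢
  rw [h1, lintegral_uniformSphere_circleRotKernel ε hf, angle_double_lintegral_symm ε hf]

/-- **THE `cpn_2d` LINK METROPOLIS HIT IS EXACT**: for every measurable weight `p > 0` on the circle,
`symMH (circleRotKernel ε) p` leaves `p · uniformSphere` invariant. -/
theorem cpnLinkMetropolis_invariant (ε : ℝ) {p : sphere (0 : E2) 1 → ℝ} (hp : Measurable p) (hp0 : ∀ s, 0 < p s) :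
    Kernel.Invariant (symMH (circleRotKernel ε) p)
      ((uniformSphere (volume : Measure E2)).withDensity fun s => ENNReal.ofReal (p s)) :=
  symMH_invariant hp hp0 (compProd_circleRotKernel_swap ε)

end Summit.Ventures.LatticeQCDFlow.Exactness
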